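import Literature.NumberTheory.EllipticCurves.SelmerGaloisAction
import Mathlib.Algebra.Ring.Action.Submonoid
import HarnessLib

/-!
# Local conditions in `H¹(K, E[n])` cut out by a SUBGROUP OF VALUES at a place: the subgroup-valued
# local kernel, and the ORDINARY local condition at a (unipotent-)admissible prime
# (Bertolini–Darmon 2005 §2.2 «ordinary ∕ singular part»; Gross–Parson; W. Zhang 2014 §4)

Topic `Literature/NumberTheory/EllipticCurves` (definition item D-KZ1-lite of cell `bsd-stepL`, seat `bsd-stepL-koly`:
the one missing object for a METHOD skeleton of crux stmt-BirchSwinnertonDyer-19574 with the level-raised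
Selmer spaces PINNED inside `H¹(K, E[3])` — planner g25 13:08:12Z «say which definition items and I file them»).

For a Weierstrass curve `W/K`, a `K`-field `E` (a completion `K_v`) and `n : ℤ`, the tree has the local kernels
`selmerLocalKer W E n` (Kummer ∕ finite condition: `x_v ↦ 0` in `H¹(E, E(K̄_E))`) and `W.torsionLocalKer E n`
(strict condition: `x_v = 0` in `H¹(E, E[n])`), both kernels of Mathlib's `ContinuousCohomology.map` along a
compatible pair. This file adds, with the same plumbing:
* `W.torsionLocMap E n : H¹(K, E[n]) →+ H¹(E, E(K̄_E)[n])` — the localisation map itself (its kernel is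
  `torsionLocalKer`, by `rfl`);
* `valuedClasses X L` — for a discrete `G`-module `M` and a subgroup `L ≤ M`, the classes of `H¹(G, M)` REPRESENTED
  by a continuous crossed homomorphism with VALUES IN `L` (= the image of `H¹(G, L) → H¹(G, M)` when `L` is
  `G`-stable; here a definition by representatives, which needs no stability hypothesis);
* `W.valuedLocalKer E n L ≤ H¹(K, E[n])` — the classes whose localisation at `E` is represented by an `L`-valued
  cocycle, `L ≤ E(K̄_E)[n]`;
* `W.ordinaryLocalKer E n := W.valuedLocalKer E n (E(K̄_E)[n])^{Γ_E}` — the ORDINARY condition at `E`: the local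
  class comes from `H¹(Γ_E, E[n]^{Γ_E})`. At a unipotent-admissible prime `q` of an elliptic curve at `p = 3`
  (`q ≡ 1 (mod 3)`, `Frob_q = ±u`, `u` unipotent `≠ 1`; koly MEMO-v1∕v2) one has `E[3]^{Γ_{K_q}} = ker N`
  (`N = u − 1`), the unique `Γ_{K_q}`-stable line = the TORIC line of every form raised at `q`, so this is exactly
  Bertolini–Darmon's ordinary condition `H¹_ord(K_q, E[p]) = im H¹(K_q, F⁺)` — the local condition of the
  level-raised Selmer group at `q` (BD05 §2.2–2.3; W. Zhang 2014 §4.1 `H¹_ord`). WARNING (scope, recorded): at a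
  BD-admissible prime for `p ≥ 5` (`p ∤ q² − 1`, `Frob_q = diag(±1, ±q)`) the toric line is the `±q`-eigenline,
  NOT `E[p]^{Γ_{K_q}}` (the `±1`-line), and `ordinaryLocalKer` is then the FINITE condition; the general
  `valuedLocalKer … L` with `L` = the toric line is the object to use there.
DEFINITIONS ONLY (the elementary API — `torsionLocalKer ≤ valuedLocalKer L` by the zero cocycle, monotonicity in
`L`, `valuedLocalKer ⊤ = ⊤` by `oneCocycleClass_surjective`, `torsionLocalKer = ker torsionLocMap` by `rfl` — is
left to the Summits-side consumers; nothing is asserted about admissible primes or Selmer groups here).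
References: [cite: BertoliniDarmon2005, §2.2–§2.3 (finite∕singular∕ordinary parts at admissible primes)]
[cite: WZhang2014, §4.1 (local conditions `H¹_ord`, `H¹_fin`)] (Gross–Parson: same local picture).
-/

noncomputable section

open scoped Classical

universe u

namespace Literature.NumberTheory.GaloisRepresentations

open CategoryTheory TopRep ContRepresentation

section Valued

variable {G : Type u} [Group G] [TopologicalSpace G] [IsTopologicalGroup G]
variable {M : Type u} [AddCommGroup M] [DistribMulAction G M] [TopologicalSpace M] [DiscreteTopology M]

/-- **Classes represented by an `L`-valued cocycle.** For a discrete `G`-module `M` and a subgroup `L ≤ M`: the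
classes `x ∈ H¹_cont(G, M)` of the form `x = [φ]` for a continuous crossed homomorphism `φ : G → M` with
`φ g ∈ L` for all `g`. When `L` is `G`-stable this is the image of `H¹(G, L) → H¹(G, M)` (an `L`-valued crossed
homomorphism of `M` is a crossed homomorphism of `L`); the definition by representatives needs no hypothesis on
`L`. Serre, *Galois Cohomology*, I.§5.1; Bertolini–Darmon 2005, §2.2. [folklore] -/
def valuedClasses (L : AddSubgroup M) :
    AddSubgroup (Literature.NumberTheory.EllipticCurves.discreteH1 G M) where
  carrier := {x | ∃ φ : contOneCocycles (Literature.NumberTheory.EllipticCurves.discreteTopRep G M),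
    (∀ g, φ.1 g ∈ L) ∧ oneCocycleClass _ φ = x}
  zero_mem' := ⟨0, fun _ ↦ L.zero_mem, oneCocycleClass_zero _⟩
  add_mem' := by
    rintro x y ⟨φ, hφ, rfl⟩ ⟨ψ, hψ, rfl⟩
    exact ⟨φ + ψ, fun g ↦ L.add_mem (hφ g) (hψ g), oneCocycleClass_add _ φ ψ⟩
  neg_mem' := by
    rintro x ⟨φ, hφ, rfl⟩
    refine ⟨-φ, fun g ↦ L.neg_mem (hφ g), ?_⟩
    have h := oneCocycleClass_sub _ (0 : contOneCocycles _) φ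
    rw [zero_sub, oneCocycleClass_zero, zero_sub] at h
    exact h

end Valued

end Literature.NumberTheory.GaloisRepresentations

namespace Literature.NumberTheory.EllipticCurves

open WeierstrassCurve Literature.NumberTheory.GaloisRepresentations CategoryTheory

section Local

variable {K : Type u} [Field K] (W : WeierstrassCurve K) (E : Type u) [Field E] [Algebra K E]

/-- **The localisation map `H¹(K, E[n]) → H¹(E, E(K̄_E)[n])`** at a `K`-field `E` (a completion `K_v`): Mathlib's
`ContinuousCohomology.map` along the compatible pair `(resGal E, torsionPointsMap W E n)` — the map whose kernel
is the tree's `W.torsionLocalKer E n`. Silverman, *AEC*, X.§4; Serre, *Galois Cohomology*, I.§2.4. [folklore] -/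
def _root_.WeierstrassCurve.torsionLocMap (n : ℤ) :
    galH1Torsion W n →+
      discreteH1 (Field.absoluteGaloisGroup E) (AddSubgroup.torsionBy (localPoints W E) n) :=
  (ContinuousCohomology.map (resGal (K := K) E)
      (resHomOfEquivariant (resGal (K := K) E) (torsionPointsMap W E n) (torsionPointsMap_smul W E n))
      1).hom.toLinearMap.toAddMonoidHom

/-- **The `L`-valued local condition at `E`**: the classes `x ∈ H¹(K, E[n])` whose localisation
`x_v ∈ H¹(E, E(K̄_E)[n])` is represented by a continuous cocycle with values in the subgroup `L ≤ E(K̄_E)[n]`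
(for `G_E`-stable `L`: `x_v ∈ im (H¹(E, L) → H¹(E, E[n]))`). With `L` = the toric line at an admissible prime
this is the local condition of the LEVEL-RAISED Selmer group (Bertolini–Darmon 2005 §2.3; W. Zhang 2014 §4.1
`H¹_ord`). [cite: BertoliniDarmon2005, §2.2–§2.3] -/
def _root_.WeierstrassCurve.valuedLocalKer (n : ℤ)
    (L : AddSubgroup (AddSubgroup.torsionBy (localPoints W E) n)) : AddSubgroup (galH1Torsion W n) :=
  (valuedClasses (G := Field.absoluteGaloisGroup E) L).comap (W.torsionLocMap E n)

/-- **The ORDINARY local condition at `E`**: `x_v` comes from `H¹(Γ_E, E[n]^{Γ_E})`, i.e. is represented by a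
cocycle with values in the `Γ_E`-FIXED `n`-torsion points. At a unipotent-admissible prime `q` (p = 3,
`Frob_q = ±u`) `E[3]^{Γ_{K_q}} = ker (u − 1)` is the toric line of every form raised at `q`, so this is
Bertolini–Darmon's `H¹_ord(K_q, E[3])`-condition; at a BD-admissible prime for `p ≥ 5` it is the FINITE
condition instead (module docstring, WARNING) — use `valuedLocalKer` with the `±q`-eigenline there.
[cite: BertoliniDarmon2005, §2.2 (H¹_ord)] [cite: WZhang2014, §4.1] -/
def _root_.WeierstrassCurve.ordinaryLocalKer (n : ℤ) : AddSubgroup (galH1Torsion W n) :=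
  W.valuedLocalKer E n
    (FixedPoints.addSubgroup (Field.absoluteGaloisGroup E) (AddSubgroup.torsionBy (localPoints W E) n))

end Local

end Literature.NumberTheory.EllipticCurves
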